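import Literature.NumberTheory.Automorphic.PlaneLatticesSelfDualRamified              -- ★ R2-B (A-p01): ramified Hermite classification, stability, count = norm fibre
import Literature.NumberTheory.Automorphic.SelfDualStableLatticeDepthCount             -- ★ A-p13 I-2 FILE 2: `sum_filter_mod_two_add_le_eq`, `map_sub_smul_one_le_iff_of_hermite` (FILE 1), (L5-d3) tokens
import Literature.NumberTheory.LocalFields.RamifiedQuadraticNormFibres                -- ★ R2-A (A-p01): `natCard_norm_fibre_quotient_pow_ramified = 2 q^{⌊n∕2⌋}`
import HarnessLib

/-!
# Level-`i` and exact-depth counts of `γ`-stable self-dual ∕ `ϖ`-modular lattices at a TAMELY RAMIFIED place, in the lattice-count socket currency: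
# `#{Λ ∈ S(ϖ^{−d} · diag h, diag(a,c)) | (γ − s·1)Λ ≤ ϖ^iΛ} = Σ_{j ≡ d (2), j + i ≤ N} m(j)`, `m(0) = 1`, `m(j) = 2q^{⌊j∕2⌋}` — the `X′`-ball `B(Λ_C, N − i)` by vertex type
(Labesse–Langlands 1979, §2 p. 8 «`δ_m = 2q^m`»; Jacobowitz 1962, §7–§8; Kottwitz 1988, §2; Serre, *Trees*, II.1.1)

Topic `NumberTheory/Automorphic`; namespace `Literature.NumberTheory.Automorphic`.  THEOREMS ONLY (no definition, no instance, no notation, no named fact, no `sorry`).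
Cell `pub/hodgecm-mathlib` (D-0151), crux H413 = `stmt-HodgeConjecture-24833`, road «R1-ram» (MEMO-R1ram §4; architect A-p16 (g27) RULINGS A-15 (b) ∕ A-17 (a)), brick
**R-2 «RAMIFIED TREE COUNTS»**, FILE R2-C (A-p01 (g21); census 95fea186 §0 (b)(c), oracle = B-p12 (g29) cert `TABLE-J-ramified.md` READING (3)).  The RAMIFIED TWIN of ★ A-p13
I-2 `SelfDualStableLatticeLevelBallCount` ∕ `…DepthCount` in their SET-BUILDER currency VERBATIM with the form token `ϖ^e • 1 ↦ ϖ^{−d} • Matrix.diagonal h`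
(`d = 0`: self-dual = EDGE MIDPOINTS; `d = 1`: `ϖ`-modular = VERTICES, = ★ A-p03's `c⁻¹ • H` convention, `setOf_modularStable_and_eq_selfDualStable_and`), over ★ R2-B
(Hermite classification at `σϖ = −ϖ`) and ★ R2-A (ramified norm fibres `2q^{⌊n∕2⌋}`).  HONEST LABEL: HC_CM is proved only modulo the printed citations (hLiu418, h413)
until rung 0 closes; nothing printed is a letter here — lattice counting over a complete DVR with a tamely ramified involution.

SETTING.  `F` with `[ValuativeRel F]`, `𝒪 = 𝒪[F]` a DVR with finite residue field (`|𝓀| = q`), complete; `σ : F →+* F` with restriction `σO` to `𝒪` an involution, RESIDUALLY TRIVIAL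
(`σO x − x ∈ 𝔪`), `2 ∈ 𝒪ˣ`, `ϖ` a uniformizing element with `σ ϖ = −ϖ`; `h : Fin 2 → F`, `|h i| = 1`, `σ (h i) = h i` (the diagonal unit Gram matrix of the rescaled
eigenframe), `r ∈ 𝒪` with `h₀ r = −h₁` and `r̄` a SQUARE (the plane is split: `−h₀h₁ ∈ N(𝒪ˣ)`); `↑γ = diag(a, c)`, `|a| = |c| = 1`, `|a − c| = |ϖ^N|` (`t ∈ E¹×E¹` regular, `N` odd
for the letter's torus — not used); `d ∈ {0, 1}` the vertex type.
* §1 STRATA: `map_sub_smul_one_le_iff_of_modular_diagonal` (level predicate on the stratum `k` ⟺ `2k − d + i ≤ N`), **`mem_selfDualStable_zpow_smul_diagonal_iff`**,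
  `mem_selfDualStable_zpow_smul_diagonal_level_iff` (membership ⟺ Hermite `T(k, y, d−k)` with `2k − d (+ i) ≤ N`).
* §2 COUNTS: `ncard_modular_hermite_diagonal_eq` (one stratum: `m q j := if j = 0 then 1 else 2·q^{j∕2}`), **`ncard_selfDualStable_zpow_smul_diagonal_level_eq_sum`**
  `= Σ_{j ≤ N, j ≡ d (2), j + i ≤ N} m q j` (+ `exists_finset_…`: the level set is a finset), hypothesis-free `finite_and_ncard_…_level_self` at `s := c`,
  **`ncard_selfDualStable_zpow_smul_diagonal_depth_eq_ite`**: exact level `i` ⇒ `if i ≤ N ∧ (N − i) % 2 = d then m q (N − i) else 0` — oracle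
  READING (3): `#A_i(N) = 2q^{(N−i)∕2}` (`1` at `i = N`), `#B_i(N) = 2q^{(N−1−i)∕2}`.

## References
* [LabesseLanglands1979] J.-P. Labesse, R. P. Langlands, *L-indistinguishability for SL(2)*, Canad. J. Math. 31 (1979), §2 p. 8.
* [Jacobowitz1962] R. Jacobowitz, *Hermitian forms over local fields*, Amer. J. Math. 84 (1962), §7–§8.
* [Kottwitz1988] R. E. Kottwitz, *Tamagawa numbers*, Ann. of Math. 127 (1988), §2.
* [Serre1980Trees] J.-P. Serre, *Trees* (1980), Ch. II §1.1.
-/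

set_option autoImplicit false

noncomputable section

open scoped ValuativeRel Matrix MatrixGroups
open Matrix ValuativeRel IsLocalRing Finset Literature.NumberTheory.LocalFields Literature.NumberTheory.Automorphic.HermitianLatticeTree

namespace Literature.NumberTheory.Automorphic

variable {F : Type*} [Field F] [ValuativeRel F] {ϖ : F} (hϖ : IsUniformizingElement ϖ) (σ : F →+* F)

/-! ## §0 The token: `S(ϖ^{−d} • diag h)` membership is `ϖ^{−d}`-unimodularity of the Gram matrix for `diag h` -/

section Token

/-- The socket token for the form `ϖ^{−d} • diag h` is `IsUnimodular₂ (ϖ^{−d} • (σg)ᵀ (diag h) g)` (★ A-p03 `formCongr_smul_form`, ★ `isUnimodular₂_iff_exists_mem_glInt`).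
[cite: Jacobowitz1962, §7–§8] -/
theorem exists_mem_glInt_coe_eq_formCongr_zpow_smul_iff (d : ℤ) (h : Fin 2 → F) (g : GL (Fin 2) F) :
    (∃ J' ∈ glInt 2 F, (J' : Matrix (Fin 2) (Fin 2) F) = formCongr σ g (ϖ ^ (-d) • Matrix.diagonal h)) ↔
      IsUnimodular₂ (ϖ ^ (-d) • formCongr σ g (Matrix.diagonal h)) := by
  rw [formCongr_smul_form, isUnimodular₂_iff_exists_mem_glInt]

end Token

/-! ## §1 The strata: Hermite lattices `T(k, y, d − k)`, the level predicate, membership -/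

section Strata

variable {σ}
variable (hσϖ : σ ϖ = -ϖ) (hσO : ∀ x ∈ 𝒪[F], σ x ∈ 𝒪[F]) {h : Fin 2 → F} (hh0 : valuation F (h 0) = 1) (hh1 : valuation F (h 1) = 1) (d : ℤ)
  {a c : F} {N : ℕ} (γ : GL (Fin 2) F) (hγ : (γ : Matrix (Fin 2) (Fin 2) F) = !![a, 0; 0, c])
  (ha : valuation F a = 1) (hc : valuation F c = 1) (hN : valuation F (a - c) = valuation F (ϖ ^ N))

include hϖ hσϖ hσO hh0 hh1 hγ hN in
/-- **LEVEL PREDICATE ON A STRATUM ⟺ `2k − d + i ≤ N`** (given the scalar conditions): for `↑γ = diag(a, c)`, `|a − c| = |ϖ^N|`, `↑g = T(k, y, d−k)` with `ϖ^{−d}`-unimodular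
Gram (`j := 2k − d` = the `X′`-distance of `Λ(g)` from the midpoint fixed by the torus): `(γ − s·1)·Λ(g) ≤ ϖ^i·Λ(g) ↔ ϖ^{−i}(a − s) ∈ 𝒪 ∧ ϖ^{−i}(c − s) ∈ 𝒪 ∧ j + i ≤ N` —
«`γ` acts on `Λ⁄ϖ^iΛ` as the scalar `s̄` iff `B(Λ, i) ⊆ B(Λ_C, N)`» (twin of ★ A-p13 `map_sub_smul_one_le_iff_of_selfDual`). [cite: LabesseLanglands1979, §2 p. 8] [cite: Kottwitz1988, §2] -/
theorem map_sub_smul_one_le_iff_of_modular_diagonal (s : F) (i : ℕ) {k : ℤ} {y : F} (g : GL (Fin 2) F)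
    (hg : (g : Matrix (Fin 2) (Fin 2) F) = !![ϖ ^ k, y; 0, ϖ ^ (d - k)]) (hmod : IsUnimodular₂ (ϖ ^ (-d) • formCongr σ g (Matrix.diagonal h))) :
    (Submodule.span 𝒪[F] (Set.range ((g : Matrix (Fin 2) (Fin 2) F))ᵀ)).map
          ((Matrix.toLin' ((γ : Matrix (Fin 2) (Fin 2) F) - s • (1 : Matrix (Fin 2) (Fin 2) F))).restrictScalars 𝒪[F]) ≤
        (Submodule.span 𝒪[F] (Set.range ((g : Matrix (Fin 2) (Fin 2) F))ᵀ)).map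
          ((Matrix.toLin' (ϖ ^ i • (1 : Matrix (Fin 2) (Fin 2) F))).restrictScalars 𝒪[F]) ↔
      ϖ ^ (-(i : ℤ)) * (a - s) ∈ 𝒪[F] ∧ ϖ ^ (-(i : ℤ)) * (c - s) ∈ 𝒪[F] ∧ 2 * k - d + i ≤ N := by
  have h0 := hϖ.ne_zero
  rw [map_sub_smul_one_le_iff_of_hermite hϖ s i γ g hγ hg]
  refine and_congr_right fun has => and_congr_right fun hcs => ?_
  have hiN : i ≤ N := le_of_zpow_neg_mul_sub_mem hϖ hN has hcs
  obtain ⟨-, hj, hu, hcong⟩ := (isUnimodular₂_zpow_smul_formCongr_hermite_diagonal_iff hϖ σ hh0 hh1 hσϖ hσO d g hg).1 hmod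
  have hac : ϖ ^ (-(i : ℤ)) * (a - c) ∈ 𝒪[F] := by
    have := Subring.sub_mem _ has hcs
    rwa [← mul_sub, sub_sub_sub_cancel_right] at this
  have e : ϖ ^ (-(i : ℤ)) * (ϖ ^ (-k) * ((a - c) * y)) = ϖ ^ (-(i : ℤ)) * (ϖ ^ (-(2 * k - d)) * (a - c)) * (ϖ ^ (k - d) * y) := by
    have e' : ϖ ^ (-k) = ϖ ^ (-(2 * k - d)) * ϖ ^ (k - d) := by rw [← zpow_add₀ h0]; congr 1; ring
    rw [e']; ring
  rw [e]
  rcases (show 2 * k - d = 0 ∨ 1 ≤ 2 * k - d by omega) with hj0 | hj1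
  · refine iff_of_true ?_ (by omega)
    rw [hj0, neg_zero, zpow_zero, one_mul]
    exact Subring.mul_mem _ hac hu
  · have hu1 : valuation F (ϖ ^ (k - d) * y) = 1 := valuation_eq_one_of_norm_congr_diagonal hϖ σ hh0 hh1 hσO hj1 hu hcong
    rw [mul_mem_integer_iff_of_valuation_eq_one hu1]
    have hval : valuation F (ϖ ^ (-(i : ℤ)) * (ϖ ^ (-(2 * k - d)) * (a - c))) = valuation F (ϖ ^ ((N : ℤ) - (2 * k - d + i))) := by
      rw [map_mul, map_mul, hN, ← map_mul, ← map_mul, ← zpow_natCast, ← zpow_add₀ h0, ← zpow_add₀ h0]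
      congr 2; ring
    rw [Valuation.mem_integer_iff, hval, ← Valuation.mem_integer_iff, zpow_uniformizer_mem_integer_iff hϖ]
    omega

include hϖ hσϖ hσO hh0 hh1 hγ ha hc hN in
/-- **MEMBERSHIP**: `Λ ∈ S(ϖ^{−d} • diag h, diag(a,c))` (a `γ`-stable lattice with `ϖ^{−d}`-unimodular Gram) iff `Λ = Λ(T(k, y, d−k))` is a Hermite lattice of the stratum `k`
with `2k − d ≤ N` (★ (L5-a) `exists_hermite_span_eq` + ★ R2-B classification ∕ stability at `i = 0`). [cite: Jacobowitz1962, §7–§8] [cite: LabesseLanglands1979, §2 p. 8] -/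
theorem mem_selfDualStable_zpow_smul_diagonal_iff [IsDiscreteValuationRing 𝒪[F]] (Λ : Submodule 𝒪[F] (Fin 2 → F)) :
    Λ ∈ {Λ : Submodule 𝒪[F] (Fin 2 → F) |
        (∃ g : GL (Fin 2) F, (∃ J' ∈ glInt 2 F, (J' : Matrix (Fin 2) (Fin 2) F) = formCongr σ g (ϖ ^ (-d) • Matrix.diagonal h)) ∧
          Λ = Submodule.span 𝒪[F] (Set.range ((g : Matrix (Fin 2) (Fin 2) F))ᵀ)) ∧
        Λ.map ((Matrix.toLin' (γ : Matrix (Fin 2) (Fin 2) F)).restrictScalars 𝒪[F]) = Λ} ↔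
      ∃ (k : ℤ) (y : F) (g : GL (Fin 2) F), (g : Matrix (Fin 2) (Fin 2) F) = !![ϖ ^ k, y; 0, ϖ ^ (d - k)] ∧
        IsUnimodular₂ (ϖ ^ (-d) • formCongr σ g (Matrix.diagonal h)) ∧
        Λ = Submodule.span 𝒪[F] (Set.range ((g : Matrix (Fin 2) (Fin 2) F))ᵀ) ∧ 2 * k - d ≤ N := by
  have h0 := hϖ.ne_zero
  have hstab : ∀ {k : ℤ} {y : F} (g : GL (Fin 2) F), (g : Matrix (Fin 2) (Fin 2) F) = !![ϖ ^ k, y; 0, ϖ ^ (d - k)] →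
      IsUnimodular₂ (ϖ ^ (-d) • formCongr σ g (Matrix.diagonal h)) →
      ((Submodule.span 𝒪[F] (Set.range ((g : Matrix (Fin 2) (Fin 2) F))ᵀ)).map ((Matrix.toLin' (γ : Matrix (Fin 2) (Fin 2) F)).restrictScalars 𝒪[F]) =
        Submodule.span 𝒪[F] (Set.range ((g : Matrix (Fin 2) (Fin 2) F))ᵀ) ↔ 2 * k - d ≤ N) := fun g hg hmod => by
    rw [map_diag_span_eq_self_iff_of_modular_hermite_diagonal hϖ σ hh0 hh1 hσϖ hσO d γ g hγ ha hc hg hmod, Valuation.mem_integer_iff, map_mul, hN,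
      ← map_mul, ← zpow_natCast, ← zpow_add₀ h0, ← Valuation.mem_integer_iff, zpow_uniformizer_mem_integer_iff hϖ]
    omega
  constructor
  · rintro ⟨⟨g₀, hsd₀, rfl⟩, hst⟩
    obtain ⟨k, l, y, g, hg, hΛ⟩ := exists_hermite_span_eq hϖ g₀
    have hsd := exists_mem_glInt_coe_eq_formCongr_of_span_eq σ (fun x => hσO x x.2) _ hΛ hsd₀
    rw [exists_mem_glInt_coe_eq_formCongr_zpow_smul_iff] at hsd
    obtain ⟨hl, -, -, -⟩ := (isUnimodular₂_zpow_smul_formCongr_hermite_diagonal_iff hϖ σ hh0 hh1 hσϖ hσO d g hg).1 hsd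
    subst hl
    refine ⟨k, y, g, hg, hsd, hΛ, ?_⟩
    rw [hΛ] at hst
    exact (hstab g hg hsd).1 hst
  · rintro ⟨k, y, g, hg, hsd, rfl, hle⟩
    exact ⟨⟨g, (exists_mem_glInt_coe_eq_formCongr_zpow_smul_iff σ d h g).2 hsd, rfl⟩, (hstab g hg hsd).2 hle⟩

include hϖ hσϖ hσO hh0 hh1 hγ ha hc hN in
/-- **MEMBERSHIP WITH A LEVEL**: under `ϖ^{−i}(a − s), ϖ^{−i}(c − s) ∈ 𝒪`, `Λ ∈ S(ϖ^{−d} • diag h, γ)` satisfies `(γ − s·1)Λ ≤ ϖ^iΛ` iff `Λ = Λ(T(k, y, d−k))` lies in a stratum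
with `2k − d + i ≤ N`. [cite: LabesseLanglands1979, §2 p. 8] [cite: Kottwitz1988, §2] -/
theorem mem_selfDualStable_zpow_smul_diagonal_level_iff [IsDiscreteValuationRing 𝒪[F]] {s : F} {i : ℕ}
    (has : ϖ ^ (-(i : ℤ)) * (a - s) ∈ 𝒪[F]) (hcs : ϖ ^ (-(i : ℤ)) * (c - s) ∈ 𝒪[F]) (Λ : Submodule 𝒪[F] (Fin 2 → F)) :
    Λ ∈ {Λ : Submodule 𝒪[F] (Fin 2 → F) |
        ((∃ g : GL (Fin 2) F, (∃ J' ∈ glInt 2 F, (J' : Matrix (Fin 2) (Fin 2) F) = formCongr σ g (ϖ ^ (-d) • Matrix.diagonal h)) ∧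
            Λ = Submodule.span 𝒪[F] (Set.range ((g : Matrix (Fin 2) (Fin 2) F))ᵀ)) ∧
          Λ.map ((Matrix.toLin' (γ : Matrix (Fin 2) (Fin 2) F)).restrictScalars 𝒪[F]) = Λ) ∧
        Λ.map ((Matrix.toLin' ((γ : Matrix (Fin 2) (Fin 2) F) - s • (1 : Matrix (Fin 2) (Fin 2) F))).restrictScalars 𝒪[F]) ≤
          Λ.map ((Matrix.toLin' (ϖ ^ i • (1 : Matrix (Fin 2) (Fin 2) F))).restrictScalars 𝒪[F])} ↔
      ∃ (k : ℤ) (y : F) (g : GL (Fin 2) F), (g : Matrix (Fin 2) (Fin 2) F) = !![ϖ ^ k, y; 0, ϖ ^ (d - k)] ∧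
        IsUnimodular₂ (ϖ ^ (-d) • formCongr σ g (Matrix.diagonal h)) ∧
        Λ = Submodule.span 𝒪[F] (Set.range ((g : Matrix (Fin 2) (Fin 2) F))ᵀ) ∧ 2 * k - d + i ≤ N := by
  constructor
  · rintro ⟨hS, hlev⟩
    obtain ⟨k, y, g, hg, hsd, hΛ, -⟩ := (mem_selfDualStable_zpow_smul_diagonal_iff hϖ hσϖ hσO hh0 hh1 d γ hγ ha hc hN Λ).1 hS
    refine ⟨k, y, g, hg, hsd, hΛ, ?_⟩
    rw [hΛ] at hlev
    exact ((map_sub_smul_one_le_iff_of_modular_diagonal hϖ hσϖ hσO hh0 hh1 d γ hγ hN s i g hg hsd).1 hlev).2.2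
  · rintro ⟨k, y, g, hg, hsd, rfl, hle⟩
    exact ⟨(mem_selfDualStable_zpow_smul_diagonal_iff hϖ hσϖ hσO hh0 hh1 d γ hγ ha hc hN _).2 ⟨k, y, g, hg, hsd, rfl, by omega⟩,
      (map_sub_smul_one_le_iff_of_modular_diagonal hϖ hσϖ hσO hh0 hh1 d γ hγ hN s i g hg hsd).2 ⟨has, hcs, hle⟩⟩

end Strata

/-! ## §2 The counts: level `i` (a sum over the strata) and exact depth (an `ite`) -/

section Count

variable {σ}
variable (σO : 𝒪[F] →+* 𝒪[F]) (hσO' : ∀ x : 𝒪[F], ((σO x : 𝒪[F]) : F) = σ x) (hσσ : ∀ x, σO (σO x) = x)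
  (hres : ∀ x : 𝒪[F], σO x - x ∈ maximalIdeal 𝒪[F]) (h2 : IsUnit (2 : 𝒪[F])) (hσϖ : σ ϖ = -ϖ)
  {h : Fin 2 → F} (hh0 : valuation F (h 0) = 1) (hh1 : valuation F (h 1) = 1) (hσh : ∀ i, σ (h i) = h i)
  (r : 𝒪[F]) (hr : h 0 * (r : F) = -h 1) (hsq : IsSquare (residue 𝒪[F] r)) {d : ℕ} (hd : d ≤ 1)
  {a c : F} {N : ℕ} (γ : GL (Fin 2) F) (hγ : (γ : Matrix (Fin 2) (Fin 2) F) = !![a, 0; 0, c])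
  (ha : valuation F a = 1) (hc : valuation F c = 1) (hN : valuation F (a - c) = valuation F (ϖ ^ N))

include hϖ hσO' hσσ hres h2 hσϖ hh0 hh1 hσh hr hsq in
/-- **THE STRATUM COUNT EVALUATED**: the `ϖ^{−d}`-modular Hermite lattices of the stratum `k` (`j = 2k − d ≥ 0`) number `m q j := if j = 0 then 1 else 2·q^{⌊j∕2⌋}` —
★ R2-B `ncard_modular_hermite_diagonal_eq_natCard` + ★ R2-A `natCard_norm_fibre_quotient_pow_ramified` (at `r̄` a square: `r` is a `σ`-fixed unit since `h₀ r = −h₁`,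
`|h i| = 1`, `σ h = h`; `j = 0`: one class). The `X′`-sphere of radius `j` about `Λ_C`: `2, 2q, 2q, 2q², …`. [cite: LabesseLanglands1979, §2 p. 8] [cite: Jacobowitz1962, §7–§8] -/
theorem ncard_modular_hermite_diagonal_eq [IsDiscreteValuationRing 𝒪[F]] [Finite (ResidueField 𝒪[F])] {q : ℕ} (hq : Nat.card (ResidueField 𝒪[F]) = q)
    (d' : ℤ) {k : ℤ} (hkd : 0 ≤ 2 * k - d') :
    {Λ : Submodule 𝒪[F] (Fin 2 → F) | ∃ (y : F) (g : GL (Fin 2) F), (g : Matrix (Fin 2) (Fin 2) F) = !![ϖ ^ k, y; 0, ϖ ^ (d' - k)] ∧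
        IsUnimodular₂ (ϖ ^ (-d') • formCongr σ g (Matrix.diagonal h)) ∧ Λ = Submodule.span 𝒪[F] (Set.range ((g : Matrix (Fin 2) (Fin 2) F))ᵀ)}.ncard =
      if 2 * k - d' = 0 then 1 else 2 * q ^ ((2 * k - d').toNat / 2) := by
  have h0 := hϖ.ne_zero
  rw [ncard_modular_hermite_diagonal_eq_natCard hϖ σ hh0 hh1 hσϖ σO hσO' hσσ r hr d' hkd]
  have hr0 : h 0 ≠ 0 := fun h00 => by rw [h00, map_zero] at hh0; exact zero_ne_one hh0
  have hrF : (r : F) = -h 1 * (h 0)⁻¹ := by field_simp; linear_combination hr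
  have hru : IsUnit r := by
    rw [(Valuation.integer.integers (valuation F)).isUnit_iff_valuation_eq_one]
    show valuation F (r : F) = 1
    rw [hrF, map_mul, Valuation.map_neg, hh1, map_inv₀, hh0, inv_one, one_mul]
  have hσr : σO r = r := Subtype.ext (by rw [hσO', hrF, map_mul, map_neg, map_inv₀, hσh, hσh])
  split_ifs with hj
  · -- `j = 0`: `𝒪 ⧸ 𝔪^0` is a point
    haveI : Subsingleton (𝒪[F] ⧸ maximalIdeal 𝒪[F] ^ (2 * k - d').toNat) := by
      rw [hj, Int.toNat_zero, Ideal.Quotient.subsingleton_iff, pow_zero, Ideal.one_eq_top]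
    exact Nat.card_eq_one_iff_unique.2 ⟨inferInstance, ⟨⟨0, Subsingleton.elim _ _⟩⟩⟩
  · have hϖO : Irreducible (⟨ϖ, hϖ.mem⟩ : 𝒪[F]) := (IsDiscreteValuationRing.irreducible_iff_uniformizer _).2 hϖ.span_eq
    have hσϖO : σO ⟨ϖ, hϖ.mem⟩ = -⟨ϖ, hϖ.mem⟩ := Subtype.ext (by rw [hσO']; push_cast; exact hσϖ)
    exact RamifiedQuadraticNorm.natCard_norm_fibre_quotient_pow_ramified σO hσσ hres hϖO hσϖO h2 hq (by omega) hru hσr hsq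

include hϖ hσO' hσσ hres h2 hσϖ hh0 hh1 hσh hr hsq hd hγ ha hc hN in
/-- **THE LEVEL-`i` SET IS A FINSET OF CARDINALITY `Σ_{j ≤ N, j ≡ d (2), j + i ≤ N} m q j`** (ramified): for `d ∈ {0, 1}`, `↑γ = diag(a, c)`, `|a| = |c| = 1`, `|a − c| = |ϖ^N|`,
a scalar `s` with `ϖ^{−i}(a − s), ϖ^{−i}(c − s) ∈ 𝒪` — the strata `k` with `2k − d = j`, `j + i ≤ N` (§1) are disjoint (★ Hermite uniqueness),
exhaust the set, and have `m q j` elements each.  On the barycentric tree: the number of type-`d` vertices of the `X′`-ball `B(Λ_C, N − i)` (twin of ★ A-p13 inert count with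
`w(j) = q^{j−1}(q+1) ↦ m(j) = 2q^{⌊j∕2⌋}` and parity `e ↦ d`). [cite: LabesseLanglands1979, §2 p. 8] [cite: Kottwitz1988, §2] [cite: Serre1980Trees, Ch. II §1.1] -/
theorem exists_finset_selfDualStable_zpow_smul_diagonal_level [IsDiscreteValuationRing 𝒪[F]] [Finite (ResidueField 𝒪[F])] {q : ℕ}
    (hq : Nat.card (ResidueField 𝒪[F]) = q) {s : F} {i : ℕ} (has : ϖ ^ (-(i : ℤ)) * (a - s) ∈ 𝒪[F]) (hcs : ϖ ^ (-(i : ℤ)) * (c - s) ∈ 𝒪[F]) :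
    ∃ U : Finset (Submodule 𝒪[F] (Fin 2 → F)), {Λ : Submodule 𝒪[F] (Fin 2 → F) |
        ((∃ g : GL (Fin 2) F, (∃ J' ∈ glInt 2 F, (J' : Matrix (Fin 2) (Fin 2) F) = formCongr σ g (ϖ ^ (-(d : ℤ)) • Matrix.diagonal h)) ∧
            Λ = Submodule.span 𝒪[F] (Set.range ((g : Matrix (Fin 2) (Fin 2) F))ᵀ)) ∧
          Λ.map ((Matrix.toLin' (γ : Matrix (Fin 2) (Fin 2) F)).restrictScalars 𝒪[F]) = Λ) ∧
        Λ.map ((Matrix.toLin' ((γ : Matrix (Fin 2) (Fin 2) F) - s • (1 : Matrix (Fin 2) (Fin 2) F))).restrictScalars 𝒪[F]) ≤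
          Λ.map ((Matrix.toLin' (ϖ ^ i • (1 : Matrix (Fin 2) (Fin 2) F))).restrictScalars 𝒪[F])} = ↑U ∧
      U.card = ∑ j ∈ (range (N + 1)).filter (fun j => j % 2 = d ∧ j + i ≤ N), (if j = 0 then 1 else 2 * q ^ (j / 2)) := by
  classical
  have hσO : ∀ x ∈ 𝒪[F], σ x ∈ 𝒪[F] := fun x hx => by rw [← hσO' ⟨x, hx⟩]; exact (σO ⟨x, hx⟩).2
  set T : ℤ → Set (Submodule 𝒪[F] (Fin 2 → F)) := fun k =>
    {Λ | ∃ (y : F) (g : GL (Fin 2) F), (g : Matrix (Fin 2) (Fin 2) F) = !![ϖ ^ k, y; 0, ϖ ^ ((d : ℤ) - k)] ∧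
        IsUnimodular₂ (ϖ ^ (-(d : ℤ)) • formCongr σ g (Matrix.diagonal h)) ∧ Λ = Submodule.span 𝒪[F] (Set.range ((g : Matrix (Fin 2) (Fin 2) F))ᵀ)} with hT
  set J : Finset ℕ := (range (N + 1)).filter (fun j => j % 2 = d ∧ j + i ≤ N) with hJ
  have hkj : ∀ j ∈ J, 2 * (((j + d) / 2 : ℕ) : ℤ) - d = (j : ℕ) ∧ j + i ≤ N := fun j hj => by
    simp only [hJ, Finset.mem_filter, Finset.mem_range] at hj
    constructor <;> omega
  have hval : ∀ j ∈ J, (T (((j + d) / 2 : ℕ) : ℤ)).ncard = if j = 0 then 1 else 2 * q ^ (j / 2) := fun j hj => by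
    have h1 := (hkj j hj).1
    rw [hT]
    simp only
    rw [ncard_modular_hermite_diagonal_eq hϖ σO hσO' hσσ hres h2 hσϖ hh0 hh1 hσh r hr hsq hq (d : ℤ) (by omega)]
    have e1 : (2 * (((j + d) / 2 : ℕ) : ℤ) - (d : ℤ)).toNat / 2 = j / 2 := by omega
    rw [e1]
    congr 1
    exact propext ⟨fun h' => by omega, fun h' => by omega⟩
  have hq1 : 1 ≤ q := by rw [← hq]; exact Nat.card_pos
  have hfin : ∀ j ∈ J, (T (((j + d) / 2 : ℕ) : ℤ)).Finite := fun j hj => by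
    refine Set.finite_of_ncard_ne_zero ?_
    rw [hval j hj]
    split_ifs
    · exact one_ne_zero
    · exact Nat.mul_ne_zero two_ne_zero (pow_ne_zero _ (by omega))
  set U : Finset (Submodule 𝒪[F] (Fin 2 → F)) := J.attach.biUnion fun j => (hfin j.1 j.2).toFinset with hU
  have hSU : {Λ : Submodule 𝒪[F] (Fin 2 → F) |
        ((∃ g : GL (Fin 2) F, (∃ J' ∈ glInt 2 F, (J' : Matrix (Fin 2) (Fin 2) F) = formCongr σ g (ϖ ^ (-(d : ℤ)) • Matrix.diagonal h)) ∧
            Λ = Submodule.span 𝒪[F] (Set.range ((g : Matrix (Fin 2) (Fin 2) F))ᵀ)) ∧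
          Λ.map ((Matrix.toLin' (γ : Matrix (Fin 2) (Fin 2) F)).restrictScalars 𝒪[F]) = Λ) ∧
        Λ.map ((Matrix.toLin' ((γ : Matrix (Fin 2) (Fin 2) F) - s • (1 : Matrix (Fin 2) (Fin 2) F))).restrictScalars 𝒪[F]) ≤
          Λ.map ((Matrix.toLin' (ϖ ^ i • (1 : Matrix (Fin 2) (Fin 2) F))).restrictScalars 𝒪[F])} =
      (U : Set (Submodule 𝒪[F] (Fin 2 → F))) := by
    ext Λ
    rw [mem_selfDualStable_zpow_smul_diagonal_level_iff hϖ hσϖ hσO hh0 hh1 (d : ℤ) γ hγ ha hc hN has hcs Λ, hU, Finset.coe_biUnion]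
    simp only [Finset.mem_coe, Finset.mem_attach, Set.iUnion_true, Set.mem_iUnion, Set.Finite.coe_toFinset]
    constructor
    · rintro ⟨k, y, g, hg, hsd, hΛ, hle⟩
      obtain ⟨-, hj0, -, -⟩ := (isUnimodular₂_zpow_smul_formCongr_hermite_diagonal_iff hϖ σ hh0 hh1 hσϖ hσO (d : ℤ) g hg).1 hsd
      have hjJ : (2 * k - d).toNat ∈ J := by
        simp only [hJ, Finset.mem_filter, Finset.mem_range]
        refine ⟨by omega, by omega, by omega⟩
      refine ⟨⟨_, hjJ⟩, ?_⟩
      have hk : ((((2 * k - (d : ℤ)).toNat + d) / 2 : ℕ) : ℤ) = k := by omega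
      rw [hT]; simp only [Set.mem_setOf_eq]
      rw [hk]
      exact ⟨y, g, hg, hsd, hΛ⟩
    · rintro ⟨⟨j, hj⟩, hmem⟩
      rw [hT] at hmem; simp only [Set.mem_setOf_eq] at hmem
      obtain ⟨y, g, hg, hsd, hΛ⟩ := hmem
      exact ⟨_, y, g, hg, hsd, hΛ, by have := hkj j hj; omega⟩
  have hdisj : (↑J.attach : Set {j // j ∈ J}).PairwiseDisjoint fun j => (hfin j.1 j.2).toFinset := by
    rintro ⟨j, hj⟩ - ⟨j', hj'⟩ - hne
    rw [Function.onFun, Set.Finite.disjoint_toFinset, Set.disjoint_left]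
    rintro Λ hΛ hΛ'
    rw [hT] at hΛ hΛ'
    simp only [Set.mem_setOf_eq] at hΛ hΛ'
    obtain ⟨y, g, hg, -, hΛg⟩ := hΛ
    obtain ⟨y', g', hg', -, hΛg'⟩ := hΛ'
    obtain ⟨hk, -, -⟩ := (span_eq_span_iff_of_hermite hϖ g g' hg hg').1 (hΛg.symm.trans hΛg')
    have h1 := (hkj j hj).1; have h2' := (hkj j' hj').1
    exact hne (Subtype.ext (show j = j' by omega))
  refine ⟨U, hSU, ?_⟩
  rw [hU, Finset.card_biUnion hdisj, ← Finset.sum_attach J]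
  refine Finset.sum_congr rfl fun j _ => ?_
  rw [← Set.ncard_eq_toFinset_card _ (hfin j.1 j.2), hval j.1 j.2]

include hϖ hσO' hσσ hres h2 hσϖ hh0 hh1 hσh hr hsq hd hγ ha hc hN in
/-- **THE LEVEL-`i` COUNT (ramified)**, scalar `s` with `ϖ^{−i}(a − s), ϖ^{−i}(c − s) ∈ 𝒪`: `#{Λ ∈ S(ϖ^{−d} • diag h, γ) | (γ − s·1)Λ ≤ ϖ^iΛ} = Σ_{j ≤ N, j ≡ d (2), j + i ≤ N} m q j`.
[cite: LabesseLanglands1979, §2 p. 8] [cite: Kottwitz1988, §2] -/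
theorem ncard_selfDualStable_zpow_smul_diagonal_level_eq_sum [IsDiscreteValuationRing 𝒪[F]] [Finite (ResidueField 𝒪[F])] {q : ℕ}
    (hq : Nat.card (ResidueField 𝒪[F]) = q) {s : F} {i : ℕ} (has : ϖ ^ (-(i : ℤ)) * (a - s) ∈ 𝒪[F]) (hcs : ϖ ^ (-(i : ℤ)) * (c - s) ∈ 𝒪[F]) :
    {Λ : Submodule 𝒪[F] (Fin 2 → F) |
        ((∃ g : GL (Fin 2) F, (∃ J' ∈ glInt 2 F, (J' : Matrix (Fin 2) (Fin 2) F) = formCongr σ g (ϖ ^ (-(d : ℤ)) • Matrix.diagonal h)) ∧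
            Λ = Submodule.span 𝒪[F] (Set.range ((g : Matrix (Fin 2) (Fin 2) F))ᵀ)) ∧
          Λ.map ((Matrix.toLin' (γ : Matrix (Fin 2) (Fin 2) F)).restrictScalars 𝒪[F]) = Λ) ∧
        Λ.map ((Matrix.toLin' ((γ : Matrix (Fin 2) (Fin 2) F) - s • (1 : Matrix (Fin 2) (Fin 2) F))).restrictScalars 𝒪[F]) ≤
          Λ.map ((Matrix.toLin' (ϖ ^ i • (1 : Matrix (Fin 2) (Fin 2) F))).restrictScalars 𝒪[F])}.ncard =
      ∑ j ∈ (range (N + 1)).filter (fun j => j % 2 = d ∧ j + i ≤ N), (if j = 0 then 1 else 2 * q ^ (j / 2)) := by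
  obtain ⟨U, hU, hcard⟩ := exists_finset_selfDualStable_zpow_smul_diagonal_level hϖ σO hσO' hσσ hres h2 hσϖ hh0 hh1 hσh r hr hsq hd γ hγ ha hc hN hq has hcs
  rw [hU, Set.ncard_coe_finset, hcard]

include hϖ hσO' hσσ hres h2 hσϖ hh0 hh1 hσh hr hsq hd hγ ha hc hN in
/-- **HYPOTHESIS-FREE FORM AT `s := c`**: for EVERY level `i`, `#{Λ ∈ S(ϖ^{−d} • diag h, γ) | (γ − c·1)Λ ≤ ϖ^iΛ} = Σ_{j ≤ N, j ≡ d (2), j + i ≤ N} m q j` — for `i ≤ N` the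
main count, for `i > N` both sides vanish (a member forces `i ≤ N`, ★ `le_of_zpow_neg_mul_sub_mem`). [cite: LabesseLanglands1979, §2 p. 8] [cite: Kottwitz1988, §2] -/
theorem finite_and_ncard_selfDualStable_zpow_smul_diagonal_level_self [IsDiscreteValuationRing 𝒪[F]] [Finite (ResidueField 𝒪[F])] {q : ℕ}
    (hq : Nat.card (ResidueField 𝒪[F]) = q) (i : ℕ) :
    {Λ : Submodule 𝒪[F] (Fin 2 → F) |
        ((∃ g : GL (Fin 2) F, (∃ J' ∈ glInt 2 F, (J' : Matrix (Fin 2) (Fin 2) F) = formCongr σ g (ϖ ^ (-(d : ℤ)) • Matrix.diagonal h)) ∧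
            Λ = Submodule.span 𝒪[F] (Set.range ((g : Matrix (Fin 2) (Fin 2) F))ᵀ)) ∧
          Λ.map ((Matrix.toLin' (γ : Matrix (Fin 2) (Fin 2) F)).restrictScalars 𝒪[F]) = Λ) ∧
        Λ.map ((Matrix.toLin' ((γ : Matrix (Fin 2) (Fin 2) F) - c • (1 : Matrix (Fin 2) (Fin 2) F))).restrictScalars 𝒪[F]) ≤
          Λ.map ((Matrix.toLin' (ϖ ^ i • (1 : Matrix (Fin 2) (Fin 2) F))).restrictScalars 𝒪[F])}.Finite ∧
    {Λ : Submodule 𝒪[F] (Fin 2 → F) |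
        ((∃ g : GL (Fin 2) F, (∃ J' ∈ glInt 2 F, (J' : Matrix (Fin 2) (Fin 2) F) = formCongr σ g (ϖ ^ (-(d : ℤ)) • Matrix.diagonal h)) ∧
            Λ = Submodule.span 𝒪[F] (Set.range ((g : Matrix (Fin 2) (Fin 2) F))ᵀ)) ∧
          Λ.map ((Matrix.toLin' (γ : Matrix (Fin 2) (Fin 2) F)).restrictScalars 𝒪[F]) = Λ) ∧
        Λ.map ((Matrix.toLin' ((γ : Matrix (Fin 2) (Fin 2) F) - c • (1 : Matrix (Fin 2) (Fin 2) F))).restrictScalars 𝒪[F]) ≤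
          Λ.map ((Matrix.toLin' (ϖ ^ i • (1 : Matrix (Fin 2) (Fin 2) F))).restrictScalars 𝒪[F])}.ncard =
      ∑ j ∈ (range (N + 1)).filter (fun j => j % 2 = d ∧ j + i ≤ N), (if j = 0 then 1 else 2 * q ^ (j / 2)) := by
  have h0 := hϖ.ne_zero
  have hσO : ∀ x ∈ 𝒪[F], σ x ∈ 𝒪[F] := fun x hx => by rw [← hσO' ⟨x, hx⟩]; exact (σO ⟨x, hx⟩).2
  have hcs : ϖ ^ (-(i : ℤ)) * (c - c) ∈ 𝒪[F] := by rw [sub_self, mul_zero]; exact zero_mem _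
  by_cases hiN : i ≤ N
  · have has : ϖ ^ (-(i : ℤ)) * (a - c) ∈ 𝒪[F] := by
      rw [Valuation.mem_integer_iff, map_mul, hN, ← map_mul, ← zpow_natCast, ← zpow_add₀ h0, ← Valuation.mem_integer_iff,
        zpow_uniformizer_mem_integer_iff hϖ]
      omega
    obtain ⟨U, hU, hcard⟩ := exists_finset_selfDualStable_zpow_smul_diagonal_level hϖ σO hσO' hσσ hres h2 hσϖ hh0 hh1 hσh r hr hsq hd γ hγ ha hc hN hq has hcs
    rw [hU, Set.ncard_coe_finset, hcard]
    exact ⟨U.finite_toSet, rfl⟩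
  · have hJ : (range (N + 1)).filter (fun j => j % 2 = d ∧ j + i ≤ N) = ∅ := Finset.filter_eq_empty_iff.2 fun j _ h' => hiN (by omega)
    rw [hJ, Finset.sum_empty]
    have hS : {Λ : Submodule 𝒪[F] (Fin 2 → F) |
        ((∃ g : GL (Fin 2) F, (∃ J' ∈ glInt 2 F, (J' : Matrix (Fin 2) (Fin 2) F) = formCongr σ g (ϖ ^ (-(d : ℤ)) • Matrix.diagonal h)) ∧
            Λ = Submodule.span 𝒪[F] (Set.range ((g : Matrix (Fin 2) (Fin 2) F))ᵀ)) ∧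
          Λ.map ((Matrix.toLin' (γ : Matrix (Fin 2) (Fin 2) F)).restrictScalars 𝒪[F]) = Λ) ∧
        Λ.map ((Matrix.toLin' ((γ : Matrix (Fin 2) (Fin 2) F) - c • (1 : Matrix (Fin 2) (Fin 2) F))).restrictScalars 𝒪[F]) ≤
          Λ.map ((Matrix.toLin' (ϖ ^ i • (1 : Matrix (Fin 2) (Fin 2) F))).restrictScalars 𝒪[F])} = ∅ := by
      refine Set.subset_empty_iff.1 fun Λ hΛ => ?_
      obtain ⟨hS, hlev⟩ := hΛ
      obtain ⟨k, y, g, hg, hsd, hΛg, -⟩ := (mem_selfDualStable_zpow_smul_diagonal_iff hϖ hσϖ hσO hh0 hh1 (d : ℤ) γ hγ ha hc hN Λ).1 hS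
      rw [hΛg] at hlev
      obtain ⟨has, -, -⟩ := (map_sub_smul_one_le_iff_of_modular_diagonal hϖ hσϖ hσO hh0 hh1 (d : ℤ) γ hγ hN c i g hg hsd).1 hlev
      exact hiN (le_of_zpow_neg_mul_sub_mem hϖ hN has hcs)
    rw [hS, Set.ncard_empty]
    exact ⟨Set.finite_empty, rfl⟩

include hϖ hσO' hσσ hres h2 hσϖ hh0 hh1 hσh hr hsq hd hγ ha hc hN in
/-- **EXACT DEPTH (ramified), type-`d` vertices**: `#{Λ ∈ S(ϖ^{−d} • diag h, γ) | (γ − c·1)Λ ≤ ϖ^iΛ ∧ ¬ (γ − c·1)Λ ≤ ϖ^{i+1}Λ} = [i ≤ N ∧ N − i ≡ d (2)]·m q (N − i)` —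
the type-`d` vertices at `X′`-distance EXACTLY `N − i` from `Λ_C`: `#A_i(N) = 2q^{(N−i)∕2}` for `i < N` even-gap, `1` at `i = N` (`d = 0`), `#B_i(N) = 2q^{(N−1−i)∕2}` (`d = 1`) =
B-p12 (g29)'s certified table READING (3) (twin of ★ A-p13 `ncard_selfDualStable_smul_one_diag_depth_eq_ite`). [cite: LabesseLanglands1979, §2 p. 8] [cite: Kottwitz1988, §2] -/
theorem ncard_selfDualStable_zpow_smul_diagonal_depth_eq_ite [IsDiscreteValuationRing 𝒪[F]] [Finite (ResidueField 𝒪[F])] {q : ℕ}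
    (hq : Nat.card (ResidueField 𝒪[F]) = q) (i : ℕ) :
    {Λ : Submodule 𝒪[F] (Fin 2 → F) |
        ((∃ g : GL (Fin 2) F, (∃ J' ∈ glInt 2 F, (J' : Matrix (Fin 2) (Fin 2) F) = formCongr σ g (ϖ ^ (-(d : ℤ)) • Matrix.diagonal h)) ∧
            Λ = Submodule.span 𝒪[F] (Set.range ((g : Matrix (Fin 2) (Fin 2) F))ᵀ)) ∧
          Λ.map ((Matrix.toLin' (γ : Matrix (Fin 2) (Fin 2) F)).restrictScalars 𝒪[F]) = Λ) ∧
        (Λ.map ((Matrix.toLin' ((γ : Matrix (Fin 2) (Fin 2) F) - c • (1 : Matrix (Fin 2) (Fin 2) F))).restrictScalars 𝒪[F]) ≤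
          Λ.map ((Matrix.toLin' (ϖ ^ i • (1 : Matrix (Fin 2) (Fin 2) F))).restrictScalars 𝒪[F]) ∧
        ¬ Λ.map ((Matrix.toLin' ((γ : Matrix (Fin 2) (Fin 2) F) - c • (1 : Matrix (Fin 2) (Fin 2) F))).restrictScalars 𝒪[F]) ≤
          Λ.map ((Matrix.toLin' (ϖ ^ (i + 1) • (1 : Matrix (Fin 2) (Fin 2) F))).restrictScalars 𝒪[F]))}.ncard =
      if i ≤ N ∧ (N - i) % 2 = d then (if N - i = 0 then 1 else 2 * q ^ ((N - i) / 2)) else 0 := by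
  obtain ⟨hfin, hi⟩ := finite_and_ncard_selfDualStable_zpow_smul_diagonal_level_self hϖ σO hσO' hσσ hres h2 hσϖ hh0 hh1 hσh r hr hsq hd γ hγ ha hc hN hq i
  obtain ⟨-, hi1⟩ := finite_and_ncard_selfDualStable_zpow_smul_diagonal_level_self hϖ σO hσO' hσσ hres h2 hσϖ hh0 hh1 hσh r hr hsq hd γ hγ ha hc hN hq (i + 1)
  rw [sum_filter_mod_two_add_le_eq _ N d i] at hi
  set Si := {Λ : Submodule 𝒪[F] (Fin 2 → F) |
        ((∃ g : GL (Fin 2) F, (∃ J' ∈ glInt 2 F, (J' : Matrix (Fin 2) (Fin 2) F) = formCongr σ g (ϖ ^ (-(d : ℤ)) • Matrix.diagonal h)) ∧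
            Λ = Submodule.span 𝒪[F] (Set.range ((g : Matrix (Fin 2) (Fin 2) F))ᵀ)) ∧
          Λ.map ((Matrix.toLin' (γ : Matrix (Fin 2) (Fin 2) F)).restrictScalars 𝒪[F]) = Λ) ∧
        Λ.map ((Matrix.toLin' ((γ : Matrix (Fin 2) (Fin 2) F) - c • (1 : Matrix (Fin 2) (Fin 2) F))).restrictScalars 𝒪[F]) ≤
          Λ.map ((Matrix.toLin' (ϖ ^ i • (1 : Matrix (Fin 2) (Fin 2) F))).restrictScalars 𝒪[F])} with hSi
  set Si1 := {Λ : Submodule 𝒪[F] (Fin 2 → F) |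
        ((∃ g : GL (Fin 2) F, (∃ J' ∈ glInt 2 F, (J' : Matrix (Fin 2) (Fin 2) F) = formCongr σ g (ϖ ^ (-(d : ℤ)) • Matrix.diagonal h)) ∧
            Λ = Submodule.span 𝒪[F] (Set.range ((g : Matrix (Fin 2) (Fin 2) F))ᵀ)) ∧
          Λ.map ((Matrix.toLin' (γ : Matrix (Fin 2) (Fin 2) F)).restrictScalars 𝒪[F]) = Λ) ∧
        Λ.map ((Matrix.toLin' ((γ : Matrix (Fin 2) (Fin 2) F) - c • (1 : Matrix (Fin 2) (Fin 2) F))).restrictScalars 𝒪[F]) ≤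
          Λ.map ((Matrix.toLin' (ϖ ^ (i + 1) • (1 : Matrix (Fin 2) (Fin 2) F))).restrictScalars 𝒪[F])} with hSi1
  have hsub : Si1 ⊆ Si := fun Λ hΛ => ⟨hΛ.1, map_le_map_pow_smul_one_of_succ hϖ.mem i _ Λ hΛ.2⟩
  have hsplit := Set.ncard_sdiff_add_ncard_of_subset hsub hfin
  rw [hi, hi1] at hsplit
  have hdiff : {Λ : Submodule 𝒪[F] (Fin 2 → F) |
        ((∃ g : GL (Fin 2) F, (∃ J' ∈ glInt 2 F, (J' : Matrix (Fin 2) (Fin 2) F) = formCongr σ g (ϖ ^ (-(d : ℤ)) • Matrix.diagonal h)) ∧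
            Λ = Submodule.span 𝒪[F] (Set.range ((g : Matrix (Fin 2) (Fin 2) F))ᵀ)) ∧
          Λ.map ((Matrix.toLin' (γ : Matrix (Fin 2) (Fin 2) F)).restrictScalars 𝒪[F]) = Λ) ∧
        (Λ.map ((Matrix.toLin' ((γ : Matrix (Fin 2) (Fin 2) F) - c • (1 : Matrix (Fin 2) (Fin 2) F))).restrictScalars 𝒪[F]) ≤
          Λ.map ((Matrix.toLin' (ϖ ^ i • (1 : Matrix (Fin 2) (Fin 2) F))).restrictScalars 𝒪[F]) ∧
        ¬ Λ.map ((Matrix.toLin' ((γ : Matrix (Fin 2) (Fin 2) F) - c • (1 : Matrix (Fin 2) (Fin 2) F))).restrictScalars 𝒪[F]) ≤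
          Λ.map ((Matrix.toLin' (ϖ ^ (i + 1) • (1 : Matrix (Fin 2) (Fin 2) F))).restrictScalars 𝒪[F]))} = Si \ Si1 := by
    ext Λ
    simp only [hSi, hSi1, Set.mem_setOf_eq, Set.mem_sdiff, not_and]
    exact ⟨fun h' => ⟨⟨h'.1, h'.2.1⟩, fun _ => h'.2.2⟩, fun h' => ⟨h'.1.1, h'.1.2, h'.2 h'.1.1⟩⟩
  rw [hdiff]
  omega

end Count

end Literature.NumberTheory.Automorphic

end
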